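import Mathlib.Geometry.Manifold.Instances.Sphere
import Mathlib.Geometry.Manifold.Diffeomorph
import Mathlib.Topology.Homotopy.Equiv
import Literature.Topology.FourManifolds.KirbyMoves
import Literature.Topology.FourManifolds.HomotopyBallSlice
import HarnessLib

/-!
# Zero-surgery homeomorphisms and slice discs in homotopy 4-balls (Manolescu–Piccirillo)

Topic `Literature/Topology/FourManifolds`; cite item `wi-03787` for route
`SmoothPoincare4/ZeroSurgeryExotic` (hypothesis `h₁` of its assembly item `Assembly4`, whose
binder is reproduced here verbatim so that specialisation is syntactic).

## Source

C. Manolescu, L. Piccirillo, *From zero surgeries to candidates for exotic definite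
4-manifolds*, J. Lond. Math. Soc. (2) 108 (2023) 2001–2036 = arXiv:2102.04391 (held; page numbers
below are those of arXiv v3).

* p. 1 (Introduction): "We use pairs `K` and `K'` with the same 0-surgeries to produce such
  examples as follows: If `K` is slice and `S³₀(K) ≅ S³₀(K')`, then by gluing the complement of the
  slice disk for `K` to the trace of the 0-surgery for `K'`, we obtain a homotopy 4-sphere `W`,
  such that `K'` bounds a disk in `W ∖ B̊⁴`. (See Problem 1.19 in [Kirby's list].) If `s(K') ≠ 0`,
  then `K'` is not slice and `W` is an exotic four-sphere."
* p. 8, **Lemma 3.3** (the general form, "folklore"): "Let `W` be a smooth, closed, oriented,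
  simply connected four-manifold. If there is a homeomorphism `φ : S³₀(K) → S³₀(K')` and `K` is
  H-slice in `W`, then `K'` is H-slice in a 4-manifold `X` with the homotopy type of `W`."
  (Def. 2.1: `K` is H-slice in `W° = W ∖ B̊⁴` if it bounds a smooth properly embedded disc `Δ`
  in `W°` with `[Δ] = 0 ∈ H₂(W°, ∂W°)`; "if a knot is slice in the usual sense, then it is H-slice
  in any `W`".)
* p. 25, §6.3: "Suppose that `K` is a slice knot, and that `K` and `K'` admit a 0-surgery
  homeomorphism `φ : S³₀(K) → S³₀(K')`. As in the proof of Lemma 3.3, we can construct the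
  homotopy 4-sphere `X = X(−K') ∪_φ V`, where `V` is any slice disk exterior for `K`."

## What is vendored

`Literature.Topology.FourManifolds.Knot.ManolescuPiccirillo2023_lemma33_sphere` — the case `W = S⁴` of Lemma 3.3 exactly as it
is used on p. 1 and in §6.3, in the tree's vocabulary:

* "`S³₀(K) ≅ S³₀(K')`" is rendered by a common surgery presentation: a manifold `Y` (modelled on
  `ℝ³`) with `(FramedLink.single K 0).IsSurgery (𝓡 3) Y` and `(FramedLink.single K' 0).IsSurgery
  (𝓡 3) Y` (`KirbyMoves.lean`; `IsSurgery` = G18's `IsIntegralSurgeryLink`, which contains the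
  smooth identification of `Y` with the surgered sphere).  This gives a DIFFEOMORPHISM
  `S³₀(K) ≅ S³₀(K')` — at least as strong as MP's homeomorphism — but an UNORIENTED one
  (`FramedLink.isSurgery_mirror_iff`: `IsSurgery` does not see orientations), whereas MP's
  conventions (§1.2) make `φ` orientation-preserving.  Nothing is lost: an orientation-reversing
  `S³₀(K) ≅ S³₀(K')` is an orientation-preserving `S³₀(K) ≅ −S³₀(K') = S³₀(K̄')` (`K̄'` the mirror,
  framing `0 ↦ −0 = 0`), Lemma 3.3 then makes `K̄'` H-slice in a homotopy 4-sphere `X`, and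
  reflecting, `K'` is H-slice in `−X`, again a homotopy 4-sphere; the conclusion below quantifies
  over ALL homotopy 4-spheres regardless of orientation (`IsHomotopyBallSlice`, whose docstring
  records exactly this closure under orientation reversal).
* "`K` is slice" is `K.IsSmoothlySlice` (`SliceRibbon.lean`), i.e. H-slice in `S⁴`
  (MP, after Def. 2.1; the class `[Δ] = 0` is automatic as `H₂(B⁴, S³) = 0`).
* "`K'` bounds a disk in `W ∖ B̊⁴` for a homotopy 4-sphere `W`" is `K'.IsHomotopyBallSlice`
  (`HomotopyBallSlice.lean`: a smooth proper disc in `Σ ∖ e(B̊⁴)` for a closed smooth `Σ ≃ₕ S⁴`;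
  again `[Δ] = 0` is automatic since `H₂(Σ°, ∂Σ°) ≅ H₂(Σ) = 0`).

It is a named fact (`def … : Prop`, D-0014); consumers take `(h : ManolescuPiccirillo2023_lemma33_sphere)`.
The second half of the p. 1 sentence ("if `K'` is not slice, `W` is an exotic four-sphere") is
the FGMW lemma `Knot.exists_exotic_of_isHomotopyBallSlice_not_isSmoothlySlice` already in the
tree; we PROVE the composite (`…​.exists_exotic`) from the two named facts.

Not vendored: the general Lemma 3.3 (arbitrary simply connected `W`), which needs "H-slice in
`W`" with the homological condition `[Δ] = 0` and "homotopy type of `W`" for 4-manifolds with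
boundary — vocabulary the tree does not have (`IsSliceDiscIn` has no homology class); the
Trace Embedding Lemma 3.5 (needs knot traces `X(K)` as smooth 4-manifolds with boundary).
-/

open scoped Manifold ContDiff Topology
open Function Set ContinuousMap

noncomputable section

namespace Literature.Topology.FourManifolds

namespace Knot

/-- **Manolescu–Piccirillo, Lemma 3.3 for `W = S⁴`** (the "zero-surgery ⇒ slice in a homotopy
ball" framework lemma; MP p. 1 and §6.3).  Let `K, K' ⊂ S³` be knots whose `0`-surgeries are
diffeomorphic — here: some `3`-manifold `Y` is `0`-surgery both on `K` and on `K'` — and suppose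
`K` is smoothly slice (in `B⁴`).  Then `K'` bounds a smoothly, properly embedded disc in
`W ∖ B̊⁴` for some closed smooth homotopy `4`-sphere `W` (namely `W = X(−K') ∪_φ V`, `V` a slice
disc exterior for `K`, glued along `∂V ≅ S³₀(K) ≅ S³₀(K') = ∂X(K')`; the disc is the core of the
`2`-handle of the trace `X(K')`).  Printed with an orientation-preserving homeomorphism
`φ : S³₀(K) → S³₀(K')`; the unoriented hypothesis used here reduces to it by passing to the mirror
`K̄'` and reversing the orientation of `W` (see the module docstring), the conclusion
`IsHomotopyBallSlice` being orientation-blind.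
[cite: ManolescuPiccirillo2023, Lemma 3.3 (case W = S⁴) with §1 p. 1 and §6.3] -/
def ManolescuPiccirillo2023_lemma33_sphere : Prop :=
  ∀ (K K' : Literature.Topology.FourManifolds.Knot) (Y : Type) [TopologicalSpace Y] [ChartedSpace (EuclideanSpace ℝ (Fin 3)) Y],
    (Literature.Topology.FourManifolds.FramedLink.single K 0).IsSurgery (𝓡 3) Y → (Literature.Topology.FourManifolds.FramedLink.single K' 0).IsSurgery (𝓡 3) Y →
      K.IsSmoothlySlice → K'.IsHomotopyBallSlice

/-- **The Manolescu–Piccirillo strategy against SPC4** (MP p. 1: "If `s(K') ≠ 0`, then `K'` is not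
slice and `W` is an exotic four-sphere"), assembled from the two named facts: given Lemma 3.3
(`W = S⁴`) and the FGMW lemma, a pair of knots with a common `0`-surgery, the first smoothly slice
and the second not, yields a closed smooth `4`-manifold homotopy equivalent but not diffeomorphic
to `S⁴`. [cite: ManolescuPiccirillo2023, §1 p. 1] -/
theorem ManolescuPiccirillo2023_lemma33_sphere.exists_exotic
    (hMP : ManolescuPiccirillo2023_lemma33_sphere)
    (hFGMW : exists_exotic_of_isHomotopyBallSlice_not_isSmoothlySlice)
    (h : ∃ (K K' : Literature.Topology.FourManifolds.Knot) (Y : Type) (_ : TopologicalSpace Y)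
      (_ : ChartedSpace (EuclideanSpace ℝ (Fin 3)) Y),
      (Literature.Topology.FourManifolds.FramedLink.single K 0).IsSurgery (𝓡 3) Y ∧ (Literature.Topology.FourManifolds.FramedLink.single K' 0).IsSurgery (𝓡 3) Y ∧
        K.IsSmoothlySlice ∧ ¬ K'.IsSmoothlySlice) :
    ∃ (M : Type) (_ : TopologicalSpace M) (_ : T2Space M) (_ : SecondCountableTopology M)
      (_ : ChartedSpace (EuclideanSpace ℝ (Fin 4)) M) (_ : IsManifold (𝓡 4) ∞ M) (_ : CompactSpace M),
      Nonempty (M ≃ₕ (Metric.sphere (0 : EuclideanSpace ℝ (Fin 5)) 1)) ∧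
        IsEmpty (M ≃ₘ⟮𝓡 4, 𝓡 4⟯ (Metric.sphere (0 : EuclideanSpace ℝ (Fin 5)) 1)) := by
  obtain ⟨K, K', Y, _, _, h1, h2, h3, h4⟩ := h
  exact hFGMW ⟨K', hMP K K' Y h1 h2 h3, h4⟩

/-- The intermediate step, isolated (MP p. 1, first sentence): under Lemma 3.3 (`W = S⁴`), a pair
of knots with a common `0`-surgery, exactly one of which is smoothly slice, gives a knot that is
slice in a homotopy `4`-ball but not in `B⁴`. [cite: ManolescuPiccirillo2023, §1 p. 1] -/
theorem ManolescuPiccirillo2023_lemma33_sphere.exists_isHomotopyBallSlice_not_isSmoothlySlice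
    (hMP : ManolescuPiccirillo2023_lemma33_sphere)
    (h : ∃ (K K' : Literature.Topology.FourManifolds.Knot) (Y : Type) (_ : TopologicalSpace Y)
      (_ : ChartedSpace (EuclideanSpace ℝ (Fin 3)) Y),
      (Literature.Topology.FourManifolds.FramedLink.single K 0).IsSurgery (𝓡 3) Y ∧ (Literature.Topology.FourManifolds.FramedLink.single K' 0).IsSurgery (𝓡 3) Y ∧
        K.IsSmoothlySlice ∧ ¬ K'.IsSmoothlySlice) :
    ∃ K : Literature.Topology.FourManifolds.Knot, K.IsHomotopyBallSlice ∧ ¬ K.IsSmoothlySlice := by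
  obtain ⟨K, K', Y, _, _, h1, h2, h3, h4⟩ := h
  exact ⟨K', hMP K K' Y h1 h2 h3, h4⟩

/-- Symmetric use: with a common `0`-surgery, if BOTH directions of Lemma 3.3 are available then
sliceness of either knot puts the other in a homotopy ball. [folklore] -/
theorem ManolescuPiccirillo2023_lemma33_sphere.symm_apply
    (hMP : ManolescuPiccirillo2023_lemma33_sphere) {K K' : Literature.Topology.FourManifolds.Knot} {Y : Type} [TopologicalSpace Y]
    [ChartedSpace (EuclideanSpace ℝ (Fin 3)) Y] (hK : (Literature.Topology.FourManifolds.FramedLink.single K 0).IsSurgery (𝓡 3) Y)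
    (hK' : (Literature.Topology.FourManifolds.FramedLink.single K' 0).IsSurgery (𝓡 3) Y) (h : K'.IsSmoothlySlice) :
    K.IsHomotopyBallSlice :=
  hMP K' K Y hK' hK h

end Knot

end Literature.Topology.FourManifolds

end
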